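import Mathlib

/-!
# Crux `WordLengthQP` (stmt-ValiantsHypothesis-6623), line `Sketch` (eps-order-ladder) —
stub `stub_letterMachine` (auxiliary file: identities, bookkeeping, the easy machine steps)

Cohn's standard form for `GE₂` / Allender–Wang 2016 (ECCC TR11-083) Theorem 14 ("no mesas"), in
the S-model: a non-zero constant row vector times a product of LETTERS (`E(ℓ) = !![1, ℓ; 0, 1]`
with `ℓ.totalDegree ≤ 1`, the swap `w = !![0, 1; 1, 0]`, invertible constant diagonal matrices
`D(d₁, d₂) = !![C d₁, 0; 0, C d₂]`) equals row `0` of `Q(L₁) ⋯ Q(Lₘ) · w ^ ε · D(d₁, d₂)` with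
`Q(L) = !![L, 1; 1, 0]`, every `Lᵢ` affine and every INTERIOR `Lᵢ` (`1 < i < m`) non-constant.
The proof is a left-to-right letter machine: the normal form is an invariant of row vectors,
maintained letter by letter through explicit `2 × 2` identities.  This file contains the
identities, the list and degree bookkeeping, and the machine steps for the letters `D`, `w` and
(`ε = 1`) `E`; the re-normalising step, the fold and the stub itself are in the main file.
-/

-- `Summit.ValiantsHypothesis.ValiantsHypothesis.…` is the tree's mandated single-conjunct layout
-- (Sub = Summit), so the duplicated namespace component is intended.
set_option linter.dupNamespace false

noncomputable section

open MvPolynomial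

namespace Summit.ValiantsHypothesis.ValiantsHypothesis.Cruxes.WordLengthQP.EpsOrderLadder

/-! ### Explicit `2 × 2` identities over a commutative ring -/

section MatrixIdentities

variable {R : Type*} [CommRing R]

/-- Product of two diagonal letters. [folklore] -/
theorem letterMachine_diag_mul_diag (p q p' q' : R) :
    (!![p, 0; 0, q] : Matrix (Fin 2) (Fin 2) R) * !![p', 0; 0, q'] =
      !![p * p', 0; 0, q * q'] := by
  simp only [Matrix.mul_fin_two]
  congr 1
  refine Matrix.vec2_eq (Matrix.vec2_eq ?_ ?_) (Matrix.vec2_eq ?_ ?_) <;> ring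

/-- A diagonal letter passes through the swap `w`, exchanging its entries. [folklore] -/
theorem letterMachine_diag_mul_swap (p q : R) :
    (!![p, 0; 0, q] : Matrix (Fin 2) (Fin 2) R) * !![0, 1; 1, 0] =
      !![0, 1; 1, 0] * !![q, 0; 0, p] := by
  simp only [Matrix.mul_fin_two]
  congr 1
  refine Matrix.vec2_eq (Matrix.vec2_eq ?_ ?_) (Matrix.vec2_eq ?_ ?_) <;> ring

/-- `w * (w * N) = N`. [folklore] -/
theorem letterMachine_swap_swap_mul (N : Matrix (Fin 2) (Fin 2) R) :
    (!![0, 1; 1, 0] : Matrix (Fin 2) (Fin 2) R) * (!![0, 1; 1, 0] * N) = N := by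
  have h : (!![0, 1; 1, 0] : Matrix (Fin 2) (Fin 2) R) * !![0, 1; 1, 0] = 1 := by
    rw [Matrix.one_fin_two, Matrix.mul_fin_two]
    congr 1
    refine Matrix.vec2_eq (Matrix.vec2_eq ?_ ?_) (Matrix.vec2_eq ?_ ?_) <;> ring
  rw [← Matrix.mul_assoc, h, one_mul]

/-- A diagonal letter passes through an elementary letter, rescaling its form:
`D * E(ℓ) = E(ℓ') * D` when `ℓ' q = p ℓ`. [folklore] -/
theorem letterMachine_diag_mul_elem (p q ℓ ℓ' : R) (h : ℓ' * q = p * ℓ) :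
    (!![p, 0; 0, q] : Matrix (Fin 2) (Fin 2) R) * !![1, ℓ; 0, 1] =
      !![1, ℓ'; 0, 1] * !![p, 0; 0, q] := by
  simp only [Matrix.mul_fin_two]
  congr 1
  refine Matrix.vec2_eq (Matrix.vec2_eq ?_ ?_) (Matrix.vec2_eq ?_ ?_)
  · ring
  · linear_combination -h
  · ring
  · ring

/-- `E(a) * N = Q(a) * (w * N)`. [folklore] -/
theorem letterMachine_elem_mul (a : R) (N : Matrix (Fin 2) (Fin 2) R) :
    (!![1, a; 0, 1] : Matrix (Fin 2) (Fin 2) R) * N = !![a, 1; 1, 0] * (!![0, 1; 1, 0] * N) := by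
  rw [← Matrix.mul_assoc]
  congr 1
  simp only [Matrix.mul_fin_two]
  congr 1
  refine Matrix.vec2_eq (Matrix.vec2_eq ?_ ?_) (Matrix.vec2_eq ?_ ?_) <;> ring

/-- `Q(L) * w * E(a) * N = Q(L + a) * w * N` (an elementary letter is absorbed into the last
continuant letter). [folklore] -/
theorem letterMachine_cont_swap_elem (L a : R) (N : Matrix (Fin 2) (Fin 2) R) :
    (!![L, 1; 1, 0] : Matrix (Fin 2) (Fin 2) R) * (!![0, 1; 1, 0] * (!![1, a; 0, 1] * N)) =
      !![L + a, 1; 1, 0] * (!![0, 1; 1, 0] * N) := by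
  simp only [← Matrix.mul_assoc]
  congr 1
  simp only [Matrix.mul_fin_two]
  congr 1
  refine Matrix.vec2_eq (Matrix.vec2_eq ?_ ?_) (Matrix.vec2_eq ?_ ?_) <;> ring

/-- `Q(b) * Q(0) * Q(a) * N = Q(b + a) * N` (a vanishing middle form). [folklore] -/
theorem letterMachine_cont_zero_cont (a b : R) (N : Matrix (Fin 2) (Fin 2) R) :
    (!![b, 1; 1, 0] : Matrix (Fin 2) (Fin 2) R) * (!![0, 1; 1, 0] * (!![a, 1; 1, 0] * N)) =
      !![b + a, 1; 1, 0] * N := by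
  simp only [← Matrix.mul_assoc]
  congr 1
  simp only [Matrix.mul_fin_two]
  congr 1
  refine Matrix.vec2_eq (Matrix.vec2_eq ?_ ?_) (Matrix.vec2_eq ?_ ?_) <;> ring

/-- Re-normalisation of a non-zero constant middle form `γ` (with `γ γ' = 1`):
`Q(b) * Q(γ) * Q(a) * w * D(p, q) = Q(b + γ') * Q(-γ² a - γ) * w * D(γ p, -γ' q)`. [folklore] -/
theorem letterMachine_renorm (γ γ' α β β' a b p q : R) (h : γ * γ' = 1) (hα : α = -(γ ^ 2))
    (hβ : β = -γ) (hβ' : β' = -γ') :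
    (!![b, 1; 1, 0] : Matrix (Fin 2) (Fin 2) R) *
        (!![γ, 1; 1, 0] * (!![a, 1; 1, 0] * (!![0, 1; 1, 0] * !![p, 0; 0, q]))) =
      !![b + γ', 1; 1, 0] *
        (!![α * a + β, 1; 1, 0] * (!![0, 1; 1, 0] * !![γ * p, 0; 0, β' * q])) := by
  subst hα hβ hβ'
  simp only [← Matrix.mul_assoc]
  simp only [Matrix.mul_fin_two]
  congr 1
  refine Matrix.vec2_eq (Matrix.vec2_eq ?_ ?_) (Matrix.vec2_eq ?_ ?_)
  · linear_combination (-p) * h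
  · linear_combination (-(q * (a * b * γ + b + a * (1 + γ * γ') + γ'))) * h
  · ring
  · linear_combination (-(q * (γ * a + 1))) * h

/-- Row `0` of `w * E(a) * N` is row `0` of `w * N`. [folklore] -/
theorem letterMachine_row_swap_elem (a : R) (N : Matrix (Fin 2) (Fin 2) R) :
    Matrix.vecMul ![1, 0] ((!![0, 1; 1, 0] : Matrix (Fin 2) (Fin 2) R) * (!![1, a; 0, 1] * N)) =
      Matrix.vecMul ![1, 0] ((!![0, 1; 1, 0] : Matrix (Fin 2) (Fin 2) R) * N) := by
  rw [← Matrix.mul_assoc, ← Matrix.vecMul_vecMul, ← Matrix.vecMul_vecMul _ _ N]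
  congr 1
  ext j
  fin_cases j <;> simp [Matrix.vecMul, dotProduct, Fin.sum_univ_two, Matrix.mul_apply]

end MatrixIdentities

/-! ### Interior bookkeeping for lists in append form -/

section ListLemmas

variable {α : Type*} (P : α → Prop)

/-- Lists of length `≤ 2` have no interior members. [folklore] -/
theorem letterMachine_interior_of_length_le (ls : List α) (h : ls.length ≤ 2) :
    ∀ (pre suf : List α) (L : α), ls = pre ++ L :: suf → pre ≠ [] → suf ≠ [] → P L := by
  rintro pre suf L rfl hpre hsuf
  exfalso
  rcases pre with _ | ⟨p, pre⟩
  · exact hpre rfl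
  rcases suf with _ | ⟨s, suf⟩
  · exact hsuf rfl
  simp only [List.cons_append, List.length_cons, List.length_append] at h
  omega

/-- The interior members of `ls ++ [a]` are the members of `ls` but the first. [folklore] -/
theorem letterMachine_interior_snoc_iff (ls : List α) (a : α) :
    (∀ (pre suf : List α) (L : α), ls ++ [a] = pre ++ L :: suf → pre ≠ [] → suf ≠ [] → P L) ↔
      ∀ (pre suf : List α) (L : α), ls = pre ++ L :: suf → pre ≠ [] → P L := by
  constructor
  · rintro h pre suf L rfl hpre
    exact h pre (suf ++ [a]) L (by simp) hpre (by simp)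
  · intro h pre suf L hls hpre hsuf
    obtain ⟨suf', c, rfl⟩ := (List.eq_nil_or_concat' suf).resolve_left hsuf
    have h' := congrArg List.dropLast hls
    rw [List.dropLast_concat,
      show pre ++ L :: (suf' ++ [c]) = (pre ++ L :: suf') ++ [c] by simp,
      List.dropLast_concat] at h'
    exact h pre suf' L h' hpre

/-- The members-but-the-first of `ls ++ [b]`. [folklore] -/
theorem letterMachine_tail_snoc_iff (ls : List α) (b : α) :
    (∀ (pre suf : List α) (L : α), ls ++ [b] = pre ++ L :: suf → pre ≠ [] → P L) ↔
      (∀ (pre suf : List α) (L : α), ls = pre ++ L :: suf → pre ≠ [] → P L) ∧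
        (ls ≠ [] → P b) := by
  constructor
  · intro h
    refine ⟨?_, fun hne => h ls [] b rfl hne⟩
    rintro pre suf L rfl hpre
    exact h pre (suf ++ [b]) L (by simp) hpre
  · rintro ⟨h, hb⟩ pre suf L hls hpre
    rcases List.eq_nil_or_concat' suf with rfl | ⟨suf', c, rfl⟩
    · have h1 := List.append_inj_left' hls rfl
      have h2 := List.append_inj_right' hls rfl
      subst h1
      obtain rfl : b = L := by simpa using h2
      exact hb hpre
    · have h' := congrArg List.dropLast hls
      rw [List.dropLast_concat,
        show pre ++ L :: (suf' ++ [c]) = (pre ++ L :: suf') ++ [c] by simp,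
        List.dropLast_concat] at h'
      exact h pre suf' L h' hpre

end ListLemmas

/-! ### Degree bookkeeping for affine forms -/

/-- Constant multiples of affine forms are affine. [folklore] -/
theorem letterMachine_deg_C_mul {σ : Type} (a : ℂ) (ℓ : MvPolynomial σ ℂ)
    (h : ℓ.totalDegree ≤ 1) : (C a * ℓ).totalDegree ≤ 1 :=
  (totalDegree_mul _ _).trans (by rw [totalDegree_C, zero_add]; exact h)

/-- Sums of affine forms are affine. [folklore] -/
theorem letterMachine_deg_add {σ : Type} (p q : MvPolynomial σ ℂ) (hp : p.totalDegree ≤ 1)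
    (hq : q.totalDegree ≤ 1) : (p + q).totalDegree ≤ 1 :=
  (totalDegree_add p q).trans (max_le hp hq)

/-- Constants are affine. [folklore] -/
theorem letterMachine_deg_C {σ : Type} (a : ℂ) : (C a : MvPolynomial σ ℂ).totalDegree ≤ 1 :=
  (totalDegree_C a).trans_le (Nat.zero_le _)

/-- Adding a constant to a non-constant polynomial keeps it non-constant. [folklore] -/
theorem letterMachine_pos_add_C {σ : Type} (L : MvPolynomial σ ℂ) (c : ℂ)
    (h : 0 < L.totalDegree) : 0 < (L + C c).totalDegree := by
  have key : L.totalDegree ≤ (L + C c).totalDegree :=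
    calc L.totalDegree = (L + C c + C (-c)).totalDegree := by
          rw [C_neg, add_neg_cancel_right]
      _ ≤ max (L + C c).totalDegree (C (-c) : MvPolynomial σ ℂ).totalDegree :=
          totalDegree_add _ _
      _ = (L + C c).totalDegree := by rw [totalDegree_C, Nat.max_zero]
  omega

/-! ### The letter machine: one step per letter

The state is a row vector in normal form `![1, 0] ᵥ* ((ls.map Q).prod * w ^ ε * D(d₁, d₂))`
(`ε ≤ 1`, `d₁ d₂ ≠ 0`, all members of `ls` affine, interior members non-constant); each letter
maps normal forms to normal forms. -/

/-- Pushing a diagonal letter through an elementary letter keeps its form affine. [folklore] -/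
theorem letterMachine_push_diag {σ : Type} (d₁ d₂ : ℂ) (hd₂ : d₂ ≠ 0) (ℓ : MvPolynomial σ ℂ)
    (hℓ : ℓ.totalDegree ≤ 1) :
    ∃ ℓ' : MvPolynomial σ ℂ, ℓ'.totalDegree ≤ 1 ∧
      (!![C d₁, 0; 0, C d₂] : Matrix (Fin 2) (Fin 2) (MvPolynomial σ ℂ)) * !![1, ℓ; 0, 1] =
        !![1, ℓ'; 0, 1] * !![C d₁, 0; 0, C d₂] :=
  ⟨C (d₁ / d₂) * ℓ, letterMachine_deg_C_mul _ _ hℓ, letterMachine_diag_mul_elem _ _ _ _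
    (by rw [mul_right_comm, ← C_mul, div_mul_cancel₀ _ hd₂])⟩

/-- Machine step for a diagonal letter `D(e₁, e₂)`: it is absorbed into the diagonal part.
[folklore] -/
theorem letterMachine_step_diag {σ : Type} (ls : List (MvPolynomial σ ℂ)) (ε : ℕ) (d₁ d₂ e₁ e₂ : ℂ)
    (hε : ε ≤ 1) (hd₁ : d₁ ≠ 0) (hd₂ : d₂ ≠ 0) (he₁ : e₁ ≠ 0) (he₂ : e₂ ≠ 0)
    (hdeg : ∀ L ∈ ls, L.totalDegree ≤ 1)
    (hint : ∀ (pre suf : List (MvPolynomial σ ℂ)) (L : MvPolynomial σ ℂ),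
      ls = pre ++ L :: suf → pre ≠ [] → suf ≠ [] → 0 < L.totalDegree) :
    ∃ (ls' : List (MvPolynomial σ ℂ)) (ε' : ℕ) (d₁' d₂' : ℂ), ε' ≤ 1 ∧ d₁' ≠ 0 ∧ d₂' ≠ 0 ∧
      (∀ L ∈ ls', L.totalDegree ≤ 1) ∧
      (∀ (pre suf : List (MvPolynomial σ ℂ)) (L : MvPolynomial σ ℂ),
        ls' = pre ++ L :: suf → pre ≠ [] → suf ≠ [] → 0 < L.totalDegree) ∧
      Matrix.vecMul (Matrix.vecMul ![1, 0]
          ((ls.map fun L => !![L, 1; 1, 0]).prod *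
            (!![0, 1; 1, 0] : Matrix (Fin 2) (Fin 2) (MvPolynomial σ ℂ)) ^ ε *
            !![MvPolynomial.C d₁, 0; 0, MvPolynomial.C d₂]))
          (!![MvPolynomial.C e₁, 0; 0, MvPolynomial.C e₂] :
            Matrix (Fin 2) (Fin 2) (MvPolynomial σ ℂ)) =
        Matrix.vecMul ![1, 0]
          ((ls'.map fun L => !![L, 1; 1, 0]).prod *
            (!![0, 1; 1, 0] : Matrix (Fin 2) (Fin 2) (MvPolynomial σ ℂ)) ^ ε' *
            !![MvPolynomial.C d₁', 0; 0, MvPolynomial.C d₂']) := by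
  refine ⟨ls, ε, d₁ * e₁, d₂ * e₂, hε, mul_ne_zero hd₁ he₁, mul_ne_zero hd₂ he₂, hdeg, hint, ?_⟩
  rw [Matrix.vecMul_vecMul, Matrix.mul_assoc, letterMachine_diag_mul_diag, ← C_mul, ← C_mul]

/-- Machine step for the swap `w`: `D * w = w * D'` and `w * w = 1`. [folklore] -/
theorem letterMachine_step_swap {σ : Type} (ls : List (MvPolynomial σ ℂ)) (ε : ℕ) (d₁ d₂ : ℂ)
    (hε : ε ≤ 1) (hd₁ : d₁ ≠ 0) (hd₂ : d₂ ≠ 0)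
    (hdeg : ∀ L ∈ ls, L.totalDegree ≤ 1)
    (hint : ∀ (pre suf : List (MvPolynomial σ ℂ)) (L : MvPolynomial σ ℂ),
      ls = pre ++ L :: suf → pre ≠ [] → suf ≠ [] → 0 < L.totalDegree) :
    ∃ (ls' : List (MvPolynomial σ ℂ)) (ε' : ℕ) (d₁' d₂' : ℂ), ε' ≤ 1 ∧ d₁' ≠ 0 ∧ d₂' ≠ 0 ∧
      (∀ L ∈ ls', L.totalDegree ≤ 1) ∧
      (∀ (pre suf : List (MvPolynomial σ ℂ)) (L : MvPolynomial σ ℂ),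
        ls' = pre ++ L :: suf → pre ≠ [] → suf ≠ [] → 0 < L.totalDegree) ∧
      Matrix.vecMul (Matrix.vecMul ![1, 0]
          ((ls.map fun L => !![L, 1; 1, 0]).prod *
            (!![0, 1; 1, 0] : Matrix (Fin 2) (Fin 2) (MvPolynomial σ ℂ)) ^ ε *
            !![MvPolynomial.C d₁, 0; 0, MvPolynomial.C d₂]))
          (!![0, 1; 1, 0] : Matrix (Fin 2) (Fin 2) (MvPolynomial σ ℂ)) =
        Matrix.vecMul ![1, 0]
          ((ls'.map fun L => !![L, 1; 1, 0]).prod *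
            (!![0, 1; 1, 0] : Matrix (Fin 2) (Fin 2) (MvPolynomial σ ℂ)) ^ ε' *
            !![MvPolynomial.C d₁', 0; 0, MvPolynomial.C d₂']) := by
  rcases (by omega : ε = 0 ∨ ε = 1) with rfl | rfl
  · refine ⟨ls, 1, d₂, d₁, le_rfl, hd₂, hd₁, hdeg, hint, ?_⟩
    rw [Matrix.vecMul_vecMul]
    simp only [pow_zero, mul_one, pow_one, Matrix.mul_assoc]
    rw [letterMachine_diag_mul_swap]
  · refine ⟨ls, 0, d₂, d₁, zero_le_one, hd₂, hd₁, hdeg, hint, ?_⟩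
    rw [Matrix.vecMul_vecMul]
    simp only [pow_zero, mul_one, pow_one, Matrix.mul_assoc]
    rw [letterMachine_diag_mul_swap, letterMachine_swap_swap_mul]

/-- Machine step for an elementary letter `E(ℓ)` when `ε = 1`: by
`Q(Lₘ) * w * E(ℓ') = Q(Lₘ + ℓ') * w` only the last form changes (nothing changes if there is
no form at all). [folklore] -/
theorem letterMachine_step_elem_one {σ : Type} (ls : List (MvPolynomial σ ℂ)) (d₁ d₂ : ℂ)
    (ℓ : MvPolynomial σ ℂ) (hd₁ : d₁ ≠ 0) (hd₂ : d₂ ≠ 0) (hℓ : ℓ.totalDegree ≤ 1)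
    (hdeg : ∀ L ∈ ls, L.totalDegree ≤ 1)
    (hint : ∀ (pre suf : List (MvPolynomial σ ℂ)) (L : MvPolynomial σ ℂ),
      ls = pre ++ L :: suf → pre ≠ [] → suf ≠ [] → 0 < L.totalDegree) :
    ∃ (ls' : List (MvPolynomial σ ℂ)) (ε' : ℕ) (d₁' d₂' : ℂ), ε' ≤ 1 ∧ d₁' ≠ 0 ∧ d₂' ≠ 0 ∧
      (∀ L ∈ ls', L.totalDegree ≤ 1) ∧
      (∀ (pre suf : List (MvPolynomial σ ℂ)) (L : MvPolynomial σ ℂ),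
        ls' = pre ++ L :: suf → pre ≠ [] → suf ≠ [] → 0 < L.totalDegree) ∧
      Matrix.vecMul (Matrix.vecMul ![1, 0]
          ((ls.map fun L => !![L, 1; 1, 0]).prod *
            (!![0, 1; 1, 0] : Matrix (Fin 2) (Fin 2) (MvPolynomial σ ℂ)) ^ 1 *
            !![MvPolynomial.C d₁, 0; 0, MvPolynomial.C d₂]))
          !![1, ℓ; 0, 1] =
        Matrix.vecMul ![1, 0]
          ((ls'.map fun L => !![L, 1; 1, 0]).prod *
            (!![0, 1; 1, 0] : Matrix (Fin 2) (Fin 2) (MvPolynomial σ ℂ)) ^ ε' *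
            !![MvPolynomial.C d₁', 0; 0, MvPolynomial.C d₂']) := by
  obtain ⟨ℓ', hℓ', hDE⟩ := letterMachine_push_diag d₁ d₂ hd₂ ℓ hℓ
  rcases List.eq_nil_or_concat' ls with rfl | ⟨ls₀, Lm, rfl⟩
  · refine ⟨[], 1, d₁, d₂, le_rfl, hd₁, hd₂, hdeg, hint, ?_⟩
    rw [Matrix.vecMul_vecMul]
    simp only [List.map_nil, List.prod_nil, one_mul, pow_one, Matrix.mul_assoc]
    rw [hDE, letterMachine_row_swap_elem]
  · refine ⟨ls₀ ++ [Lm + ℓ'], 1, d₁, d₂, le_rfl, hd₁, hd₂, ?_, ?_, ?_⟩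
    · intro L hL
      rw [List.mem_append, List.mem_singleton] at hL
      rcases hL with hL | rfl
      · exact hdeg L (List.mem_append_left _ hL)
      · exact letterMachine_deg_add _ _ (hdeg Lm (by simp)) hℓ'
    · exact (letterMachine_interior_snoc_iff _ _ _).mpr
        ((letterMachine_interior_snoc_iff _ _ _).mp hint)
    · rw [Matrix.vecMul_vecMul]
      simp only [List.map_append, List.map_cons, List.map_nil, List.prod_append, List.prod_cons,
        List.prod_nil, mul_one, pow_one, Matrix.mul_assoc]
      rw [hDE, letterMachine_cont_swap_elem]

end Summit.ValiantsHypothesis.ValiantsHypothesis.Cruxes.WordLengthQP.EpsOrderLadder
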